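import Summits.QuantumFields.YangMills.Theorems.BalabanUVNodesN22KernelLimitOfNestedTermsModel
import Literature.MathematicalPhysics.QuantumFieldTheory.Balaban1983to89.T4ActivityRecursionWitness

/-!
# THE NESTED-POLYMERS TOWER — DEFINITIONS (A6 lane, dag-n22-w3): nested straight polymers of def-T's torus catalogue, the nested `ClusterStep`, the origin reading, the tower

Cell `pub-ymgap`, Track A (HUMAN RULING D-0062), WIDTH SEAT `dag-n22-w3` g5 on node n22 = NE9, A6-residue lane; DEFINITION lane, `--supports stmt-QuantumFields-27366` (KEY MAP v2:
K3⁸), COUNT-NEUTRAL; 6 small `def`s + the structural lemmas their construction needs; 0 `sorry`; no `instance`, no `notation`.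

WHAT AND WHY.  The (1.21)-existence road of this lineage ([I] p. 264 «This limit exists by the localized representation (1.7)») has, at def-W1's ACTUAL objects — the (1.7)∕(2.14)
localized sum `Node00.localizedSum F S emb` of a family of `ClusterTower`s whose (2.13) terms are `W1.ClusterStep.E` = the Kotecký–Preiss resummation `B13Resummation.locE` on def-T's
torus catalogue `Sect2.domSys` — only DEGENERATE inhabitants (the termless tower, the zero chart).  The sequels `…N22NestedPolymersKP ∕ Terms ∕ Limit` (this seat) fire the road's
hard schema (p597055) at a GENUINE tower; this file holds the OBJECTS:
* `segPt`, `segCubes`, `segDom` — the STRAIGHT POLYMER `{0, e, 2e, …, i·e}` of the torus with `n` cubes per direction (a torus-face-connected family of cubes, `tFaceConnected_segCubes`),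
  as an element of def-T's `TDom`; the polymers are NESTED (`segCubes_mono`) and all contain the cube `0`;
* `nestedStep P M k l₀ a m : W1.ClusterStep P ℂ M k` — indices `ℕ`, the indices `i ≤ m` localize at `segDom i`, generic term `i` at the young couplings `g = (g_0, …, g_k)` = the activity
  `a i g · 𝐔(b₀)` reading the complex configuration at the bond `b₀ = ⟨0, l₀⟩` ([II] (2.9)–(2.11) shape: ONE activity per polymer, the sum of its terms; the amplitude may read the
  coupling history, [II] (2.13)–(2.14));
* `originReading F : Node00.ReadingMaps F ℝ ℂ` — the probe field of the `K`-th torus read as the constant pair `(U(e₀, window origin), 0)`;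
* `nestedTower F M a : (K : ℕ) → W1.ClusterTower (F.P K) ℂ M` — on the `K`-th torus, at every level `k`, the nested step with amplitudes `a k` and `min K (n−1) + 1` polymers (the cap
  keeps them distinct at every volume and equals `K + 1` from the volume threshold on).

HONEST FRAMING (binding).  A MODEL-LEVEL A6 witness (test activities on def-T's catalogue, scalar probe algebra `𝔄 = ℝ`, `ρ = id`, one colour; the activities read the probe
configuration at ONE bond and do not read the couplings): NOT Bałaban's activities (2.9)–(2.11), NOT the towers OF RECORD, NOT a reading OF RECORD; inhabits NO letter OF RECORD;
nothing of Bałaban's asserted or constructed; (1.21)'s existence for the terms OF RECORD is NOT proved; N22 NOT discharged; K3⁸ `SpineGivenEndpointR13SepCoPHV` OPEN, not claimed, no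
stub touched; counts UNMOVED (typed 28∕28 · discharged 5∕27; the chair's single count line is the only count); one finite 𝕋⁴ programme at fixed ε — R4 closes the CONDITIONAL rung
`BalabanLadder.UV` only; NOTHING about the continuum limit, ℝ⁴, OS axioms or a mass gap is proved or claimed; the Yang–Mills mass gap (Clay) is NOT proved by any of this.  No cite
tags (Summit side); TYPES only: [I] = [Balaban1987RG1] CMP **109** (1987) (1.7) p. 261, (1.20)–(1.21) p. 264; [II] = [Balaban1988RG2Cluster] CMP **116** (1988) (2.9)–(2.14) pp. 14–15;
[KP86] = Kotecký–Preiss, CMP **103** (1986) (2)–(3).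
-/

noncomputable section

open Finset Filter Topology
open scoped BigOperators

namespace YMDAG.N22.AtKernels.NestedPolymers

open Literature.Probability.LatticeModels
open Literature.MathematicalPhysics.QuantumFieldTheory.Balaban1983to89
open Literature.MathematicalPhysics.QuantumFieldTheory.Balaban1983to89.T4ActivityRecursionWitness (one_add_mul_mem_slitPlane isCompatible_singleton)
open Literature.MathematicalPhysics.QuantumFieldTheory.Balaban1983to89.B13Resummation (locE)
open Literature.MathematicalPhysics.QuantumFieldTheory.Balaban1983to89.B13FamilySum (coveringFamilies mem_coveringFamilies)
open Literature.MathematicalPhysics.QuantumFieldTheory.Balaban1983to89.TreeLengthTorus (TPt TAdj TStepIn TLinked TFaceConnected IsTDom TDom tsys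
  tadj_update_add_one)
open Literature.MathematicalPhysics.QuantumFieldTheory.Balaban1983to89.TreeLengthTorusGeometry (TTouch ttouch_symm tgeometry)
open Literature.MathematicalPhysics.QuantumFieldTheory.Balaban1983to89.T4Continuum (T4Family)
open Literature.MathematicalPhysics.QuantumFieldTheory.Balaban1983to89.Node00 (siteOfInt polScalar polWindow polLimit PolLimitExists TermFamily1)
open Literature.MathematicalPhysics.QuantumFieldTheory.Balaban1983to89.Node00.Sect2 (domSys domCount CPair)
open Literature.MathematicalPhysics.QuantumFieldTheory.Balaban1983to89.B14.Eq213MaximalDomains (side)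
open Literature.MathematicalPhysics.QuantumFieldTheory.Balaban1983to89.Node00.W1 (ClusterStep ClusterTower)
open Literature.MathematicalPhysics.QuantumFieldTheory.Balaban1983to89.Node00.LocalizedSum17 (localizedSum ReadingMaps)
open Literature.MathematicalPhysics.QuantumFieldTheory.Balaban1983to89.Node00.U3KernelLetters (PolLimitsExist)
open Literature.MathematicalPhysics.QuantumFieldTheory.Balaban1983to89.Node00.U3OfKernels (histPrefix)
open YMDAG.N18.FiniteVolumeLettersModel (bondEval bondEval_apply siteOfInt_eventually_ne)
open YMDAG.N22.AtKernels.NestedTermsModel (exists_threshold_siteOfInt)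
open Literature.MathematicalPhysics.QuantumFieldTheory.Balaban1983to89.B12PolarizationTensor120 (polTensor polComp expChart)

/-! ## §1 Nested straight polymers of the torus catalogue -/

section Segments

variable {d n : ℕ}

/-- The cube `j·e_{l₀}` of the torus with `n` cubes per direction. -/
def segPt (l₀ : Fin d) (j : ℕ) : TPt d n := Function.update (0 : TPt d n) l₀ (j : ZMod n)

/-- The straight polymer `{0, e_{l₀}, …, i·e_{l₀}}` (as a family of cubes). -/
def segCubes (n : ℕ) (l₀ : Fin d) (i : ℕ) : Finset (TPt d n) := (Finset.range (i + 1)).image (segPt (n := n) l₀)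

/-- One step along the polymer: `(j+1)·e = j·e + e` (as an update of the `l₀`-coordinate). -/
theorem segPt_succ (l₀ : Fin d) (j : ℕ) : (segPt l₀ (j + 1) : TPt d n) = Function.update (segPt l₀ j) l₀ ((segPt (n := n) l₀ j) l₀ + 1) := by
  unfold segPt
  rw [Function.update_idem, Function.update_self]
  push_cast
  rfl

/-- The polymer starts at the cube `0`. -/
theorem segPt_zero (l₀ : Fin d) : (segPt l₀ 0 : TPt d n) = 0 := by
  unfold segPt; simp

/-- Membership in the straight polymer. -/
theorem mem_segCubes {l₀ : Fin d} {i : ℕ} {x : TPt d n} : x ∈ segCubes n l₀ i ↔ ∃ j ≤ i, segPt l₀ j = x := by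
  simp [segCubes]

/-- The cubes `j·e`, `j ≤ i`, belong to the `i`-th polymer. -/
theorem segPt_mem_segCubes (l₀ : Fin d) {i j : ℕ} (h : j ≤ i) : (segPt l₀ j : TPt d n) ∈ segCubes n l₀ i :=
  mem_segCubes.2 ⟨j, h, rfl⟩

/-- Every nested polymer contains the cube `0`. -/
theorem zero_mem_segCubes (l₀ : Fin d) (i : ℕ) : (0 : TPt d n) ∈ segCubes n l₀ i := by
  rw [← segPt_zero l₀]; exact segPt_mem_segCubes l₀ (Nat.zero_le i)

/-- The polymers are non-empty. -/
theorem segCubes_nonempty (l₀ : Fin d) (i : ℕ) : (segCubes n l₀ i).Nonempty := ⟨0, zero_mem_segCubes l₀ i⟩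

/-- THE POLYMERS ARE NESTED: `seg i ⊆ seg i'` for `i ≤ i'`. -/
theorem segCubes_mono (l₀ : Fin d) {i i' : ℕ} (h : i ≤ i') : segCubes n l₀ i ⊆ segCubes n l₀ i' :=
  Finset.image_subset_image (Finset.range_mono (Nat.succ_le_succ h))

/-- `0` is chain-connected to `j·e` inside the segment, for `j ≤ i`. -/
theorem tLinked_segCubes_zero (l₀ : Fin d) {i j : ℕ} (h : j ≤ i) : TLinked (segCubes n l₀ i) 0 (segPt l₀ j) := by
  induction j with
  | zero => rw [segPt_zero]; exact Relation.ReflTransGen.refl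
  | succ j ih =>
    refine (ih (Nat.le_of_succ_le h)).tail ⟨segPt_mem_segCubes l₀ (Nat.le_of_succ_le h), segPt_mem_segCubes l₀ h, ?_⟩
    rw [segPt_succ]
    exact tadj_update_add_one _ _

/-- A wall step inside a family can be walked back. -/
theorem tStepIn_symm {S : Finset (TPt d n)} {a b : TPt d n} (h : TStepIn S a b) : TStepIn S b a := ⟨h.2.1, h.1, h.2.2.symm⟩

/-- Chain-connectedness inside a family is symmetric. -/
theorem tLinked_symm {S : Finset (TPt d n)} {a b : TPt d n} (h : TLinked S a b) : TLinked S b a := by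
  unfold TLinked at h ⊢
  induction h with
  | refl => exact Relation.ReflTransGen.refl
  | tail _ hbc ih => exact Relation.ReflTransGen.head (tStepIn_symm hbc) ih

/-- The segment is torus-face-connected. -/
theorem tFaceConnected_segCubes (l₀ : Fin d) (i : ℕ) : TFaceConnected (segCubes n l₀ i) := by
  intro x hx y hy
  obtain ⟨j, hj, rfl⟩ := mem_segCubes.1 hx
  obtain ⟨j', hj', rfl⟩ := mem_segCubes.1 hy
  exact (tLinked_symm (tLinked_segCubes_zero l₀ hj)).trans (tLinked_segCubes_zero l₀ hj')

variable [NeZero n]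

/-- The straight polymer as a localization domain of the torus catalogue. -/
def segDom (n : ℕ) [NeZero n] (l₀ : Fin d) (i : ℕ) : TDom d n := ⟨segCubes n l₀ i, segCubes_nonempty l₀ i, tFaceConnected_segCubes l₀ i⟩

/-- The footprint of the polymer domain is the polymer. -/
@[simp] theorem segDom_val (l₀ : Fin d) (i : ℕ) : (segDom n l₀ i).1 = segCubes n l₀ i := rfl

end Segments

/-! ## §2 The nested cluster step, the origin reading, the tower -/

section Tower

variable (P : Params) (M k : ℕ)

/-- One step of the NESTED-POLYMERS TOWER on the torus `T^{(k+1)}` (cube side `M`): polymer index set `ℕ`, the indices `i ≤ m` localize at the straight polymer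
`segDom i = {0, e, …, i·e}` (direction `l₀`), and the generic term `i` at the young couplings `g` is the activity `a i g · 𝐔(b₀)` reading the complex configuration at the bond
`b₀ = ⟨0, l₀⟩` (the real amplitude `a i g` may read the coupling history). -/
def nestedStep (l₀ : Fin P.d) (a : ℕ → (Fin (k + 1) → ℝ) → ℝ) (m : ℕ) : ClusterStep P ℂ M k where
  Idx := ℕ
  idx := fun Z => by
    classical
    exact (Finset.range (m + 1)).filter fun i => segDom (domCount P M (k + 1)) l₀ i = Z
  T := fun i g φ => (a i g : ℂ) * φ.1 ⟨default, l₀⟩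

end Tower

section Family

variable (F : T4Family) (M : ℕ)

/-- **THE ORIGIN READING** (a MODEL reading map, `𝔄 = ℝ`, `𝔸 = ℂ`): the probe field `U` of the `K`-th torus is read as the CONSTANT complex configuration pair
`(U(e₀, window origin), 0)`. -/
def originReading : ReadingMaps F ℝ ℂ :=
  fun K k U => (fun _ => ((U (Fin.cast (F.P_d K).symm 0) (siteOfInt F K (k + 1) 0) : ℝ) : ℂ), fun _ => 0)

/-- **THE NESTED-POLYMERS TOWER** of the family: on the `K`-th torus, at every level `k`, the nested step with `min K (n − 1) + 1` polymers (`n` = cubes per direction of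
`T^{(k+1)}_K`; the cap keeps the polymers distinct at EVERY volume, and is `K + 1` from the volume threshold on), direction `e₀`, history-reading amplitudes `a k`. -/
def nestedTower (a : (k : ℕ) → ℕ → (Fin (k + 1) → ℝ) → ℝ) : (K : ℕ) → ClusterTower (F.P K) ℂ M :=
  fun K k => nestedStep (F.P K) M k (Fin.cast (F.P_d K).symm 0) (a k) (min K (domCount (F.P K) M (k + 1) - 1))

end Family

end YMDAG.N22.AtKernels.NestedPolymers

end
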